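import Summits.QuantumFields.BalabanUV.T4Continuum.Support.NE3CurlPairedResidualMulti
import Summits.QuantumFields.BalabanUV.T4Continuum.Support.NE3EnergyResidual
import Summits.QuantumFields.BalabanUV.T4Continuum.Support.NE3EnergyWeightedShapes
import HarnessLib

/-!
# T⁴ programme, node NE3 — row E-RES♯, sub-row R♯5 (assembly), file (5b): THE SOCKET (RES♯) `CurlPairedResidual` BY NAME from
# the curl-paired residual of file (5a) and a CURL-CONTROLLED EXACT LIFT (R♯3b-TYPE hypothesis on an abstract lift operator)

NE3 formalisation swarm, LEAF PROVER 02 (unit `b2b-balaban-t4-ne3-formalise-leaf-02`, gen 4; cell `pub-balaban`); owner CUT «E-RES♯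
INTO ROWS» (journal 2026-08-20T14:09Z), row (R♯5); SHAPE `t4/formal/NE3/Statements/E-RES-R5-SHAPE-v1.md`.  TEMPLATE: road P2's
`NE3EnergyResidual.abs_deriv_action_le_residualScale` (the ℓ²-paired residual of the block-averaged run-B minimiser in P2's currency,
from NE3-R2's `dualResidual_avgIter`), here with (5a)'s CURL-PAIRED `residualPairing_avgIter` and an EXACT lift `lift Y` of the
run-A direction `Y` whose dressed curl is controlled (the content of R♯3b: leaf-01-g4's `spreadLift`∕`spreadInverse` road or the
owner lineage's `dsliceDir` road — EITHER instantiates the hypotheses `hLex`∕`hLcurl`∕`hLdirL1`∕`hLcurlL1` below).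

SETTING (as in P2's template): levels `j+1` (run A, torus `N·L^{j+1}`) and `j+2` (run B); `U_B` a minimiser of the owner's class
`sfClass L N ε` at level `j+2` with datum `V` (`IsMinimiser`), `Regular d L N b g (j+2) U_B` with `0 ≤ b < ε`, multi-level smallness
`LevelSmall d L (j+1) (ε∕(L^{j+2})²)`; `W := cavg L U_B`; plaquette radius `a := b∕(L^{j+2})²`.

CONTENT ([folklore]; 0 `def`, 0 sorry):
* §1 bookkeeping: `dirL1_le_sqrt_mul_energyNormW`, `sqrt_dirSq_le_pow_mul_energyNormW` (weighted currency: `√dirSq ≤ L^k·energyNormW`,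
  `dirL1 ≤ √(d·P^d)·√dirSq`);
* §2 **`abs_dAction_le_of_exact_lift`** — for every `Y` tangent to run A's fibre at `W` (`TangentIter L j W Y`) admitting an
  exact lift `ψ` (skew, `(N·L^{j+2})`-periodic, `pushDir L U_B ψ (L•y) κ = Y y κ`, three norm bounds with constants `c₁…c₄`):
  `|dAction W Y (perWin (N·L^{j+1}))| ≤ r · energyNormW L (j+1) W Y (periodBox (N·L^{j+1}))` with the DISPLAYED
  `r = L^{4−d}·wallConst·[√(g·N^d·(L^{j+2})^{d−6})·(c₁ + c₂·a·L^{j+1}) + a²·(c₃ + c₄)·√(d·(N·L^{j+1})^d)·L^{j+1}]`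
  ((5a) at `ψ`; the coarse derivative IS `dAction W Y` by `NE3EnergyResidual.fineAction_vary_cavg` +
  `AveragingDeficitDualResidual.coarseActionOf_vary_congr` + `NE3HessForm.hasDerivAt_fineAction_vary_at`);
* §3 **`curlPairedResidual_of_exists_lift`** — the SOCKET: `CurlPairedResidual L (j+1) W T r (periodBox (N·L^{j+1}))` for every
  `T ⊆ {Y | IsSkewDir Y ∧ IsPeriodicDir Y (N·L^{j+1}) ∧ TangentIter L j W Y}` from the EXISTENCE of such a lift for every such `Y`
  (Landau not used); `curlPairedResidual_of_lift` — the same for a lift OPERATOR.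
(RES♯) is thereby KERNEL MODULO the lift hypotheses (R♯3b: e.g. `NE3SpreadLiftCurl.sqrt_curlSq_spreadLift_le` with `c₁ = √(L^{d−2})`,
`c₂ = 2048(d+4)²L²√(d·L^d)`, `c₃ = L^{d−1}`, `c₄ = 8dL^d` on `spreadLift`, made push-exact by `SpreadLift.spreadInverse` ∕ the R♯4
correction `NE3LiftDefectCorrection.exists_exact_lift_of_pushDefect`); the comparison of `r` with `C′·NE3EnergyShapes.residualScale`
is left displayed (`a·L^{j+1} = b∕(L·L^{j+2}) ≤ b`: the extra terms are «a-weighted, harmless»).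

HONEST FRAMING.  Assembly of landed kernel theorems at ONE pair of levels; the lift's existence∕curl bound (R♯3b) is a HYPOTHESIS; nothing
printed is a hypothesis (context: [Balaban1985Variational] (26)–(27) p.282, §E (115)–(121) p.295); (RES♯) NOT proved unconditionally,
T-E_w♯, NE3 NOT proved; spine PROVED 0∕9; finite T⁴ rung (B)+1 — NOT infinite volume, NOT mass gap, NOT `BetaPertH`, NOT Clay.
PLACEMENT: `Summits/QuantumFields/BalabanUV/`.  HONEST DEPENDENCY: continuum YM on T⁴ ⇐ BetaPertH ∧ nine spine estimates (0/9
proved); BetaPertH ⇐ (D1) ∧ (D4) ∧ CAP+tail; G-an2-4 gates asym, D1 and NE2/3/4.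
-/

set_option autoImplicit false

open scoped BigOperators Matrix Matrix.Norms.L2Operator
open NormedSpace Finset

namespace Summit.QuantumFields.BalabanUV.T4Continuum.NE3CurlPairedResidualEnd

open Literature.MathematicalPhysics.QuantumFieldTheory.Balaban1983to89
open B7Prop1Explicit B7Prop2Explicit MatrixLog UnitaryModel
open T4AveragingDeficitWall hiding Site Plane Plaq Bond
open T4AveragingDeficitWallBoundary (IsPeriodicCfg periodBox blockSites_periodBox)
open AveragingDeficitPeriodicCounting (IsPeriodicDir)
open AveragingDeficitDerivWallProof (wallConst wallConst_nonneg)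
open AveragingDeficitResidualPairing (coarseActionOf pushDir)
open AveragingDeficitDualResidual (coarseL1 coarseSq coarseL1_le_sqrt coarseSq_nonneg coarseActionOf_vary_congr)
open AveragingDeficitChartCalculus (cavg)
open AveragingDeficitMultiLevelPrep (tower LevelSmall TangentIter cpush)
open AveragingDeficitMultiLevelBridge (tower_eq)
open MinimalActionLevels (perWin)
open MinimalActionSandwich (IsMinimiser)
open MinimalActionRate (Regular sfClass)
open NE3HessForm (dAction hasDerivAt_fineAction_vary_at)
open NE3EnergyShapes (residualScale)
open NE3EnergyWeightedShapes (energyNormW energyNormW_nonneg CurlPairedResidual sqrt_curlSq_le_energyNormW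
  weighted_sqrt_dirSq_le_energyNormW)
open NE3EnergyResidual (fineAction_le_of_isMinimiser liftDir liftDir_smul fineAction_vary_cavg coarseSq_eq_dirSq)
open NE3CurlPairedResidualMulti (residualPairing_avgIter)

noncomputable section

variable {d : ℕ} {n : Type*} [Fintype n] [DecidableEq n]

/-! ## §1 Weighted-currency bookkeeping -/

/-- `√dirSq Z F ≤ L^k · energyNormW L k W Z F` (`L ≥ 1`). [folklore] -/
theorem sqrt_dirSq_le_pow_mul_energyNormW {L : ℕ} (hL : 1 ≤ L) (k : ℕ) (W : Site d → Fin d → (Matrix n n ℂ)ˣ)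
    (Z : Site d → Fin d → Matrix n n ℂ) (F : Finset (Site d)) :
    Real.sqrt (dirSq Z F) ≤ (L : ℝ) ^ k * energyNormW L k W Z F := by
  have h := weighted_sqrt_dirSq_le_energyNormW hL k W Z F
  have hLk : (0 : ℝ) < (L : ℝ) ^ k := pow_pos (by exact_mod_cast (by omega : 0 < L)) k
  have := mul_le_mul_of_nonneg_left h hLk.le
  rwa [← mul_assoc, mul_inv_cancel₀ hLk.ne', one_mul] at this

/-- `dirL1 Z (periodBox P) ≤ √(d·P^d) · √dirSq Z (periodBox P)` (Cauchy–Schwarz, `coarseL1_le_sqrt`). [folklore] -/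
theorem dirL1_le_sqrt_mul_sqrt_dirSq (P : ℕ) (Z : Site d → Fin d → Matrix n n ℂ) :
    dirL1 Z (periodBox P) ≤ Real.sqrt ((d : ℝ) * (P : ℝ) ^ d) * Real.sqrt (dirSq Z (periodBox P)) := by
  have h := coarseL1_le_sqrt P Z
  rw [(coarseSq_eq_dirSq P Z).1, (coarseSq_eq_dirSq P Z).2] at h
  exact h

/-! ## §2 The curl-paired residual of `W = cavg L U_B` against a tangent run-A direction, via an exact curl-controlled lift -/

/-- **(RES♯) PER DIRECTION, MODULO AN EXACT CURL-CONTROLLED LIFT.**  Levels `j+1` (run A) and `j+2` (run B); `U_B` a minimiser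
of `sfClass L N ε` at level `j+2` with datum `V`, `Regular d L N b g (j+2) U_B`, `0 ≤ b < ε`, `LevelSmall d L (j+1) (ε∕(L^{j+2})²)`;
`W := cavg L U_B`, `a := b∕(L^{j+2})²`, `F := periodBox (N·L^{j+1})`, `F_B := periodBox (N·L^{j+2})`.  Let `Y` be tangent to
run A's fibre at `W` (`TangentIter L j W Y`) and let `ψ` be ANY skew `(N·L^{j+2})`-periodic fine direction with
`pushDir L U_B ψ (L•y) κ = Y y κ` (EXACT lift) and `√curlSq U_B ψ F_B ≤ c₁·√curlSq W Y F + c₂·a·√dirSq Y F`,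
`dirL1 ψ F_B ≤ c₃·dirL1 Y F`, `curlL1 U_B ψ F_B ≤ c₄·dirL1 Y F` (`cᵢ ≥ 0`; the content of R♯3b∕R♯4 for the dressed lift).  THEN
`|dAction W Y (perWin (N·L^{j+1}))| ≤ L^{4−d}·wallConst·[√(g·N^d·(L^{j+2})^d∕(L^{j+2})^6)·(c₁ + c₂·a·L^{j+1})
+ a²·(c₃ + c₄)·√(d·(N·L^{j+1})^d)·L^{j+1}] · energyNormW L (j+1) W Y F`. [folklore] -/
theorem abs_dAction_le_of_exact_lift [Nonempty n] {L N : ℕ} [NeZero L] [NeZero N] (hL : 1 ≤ L) (j : ℕ) {ε b g : ℝ}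
    (hb : 0 ≤ b) (hbε : b < ε) (hsmall : LevelSmall d L (j + 1) (ε / ((L : ℝ) ^ (j + 2)) ^ 2))
    {V UB : Site d → Fin d → (Matrix n n ℂ)ˣ} (hB : IsMinimiser d (sfClass d L N ε) L N (j + 2) V UB)
    (hreg : Regular d L N b g (j + 2) UB) {c₁ c₂ c₃ c₄ : ℝ} (hc₁ : 0 ≤ c₁) (hc₂ : 0 ≤ c₂) (hc₃ : 0 ≤ c₃) (hc₄ : 0 ≤ c₄)
    (Y : Site d → Fin d → Matrix n n ℂ) (hYT : TangentIter L j (cavg L UB) Y)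
    {ψ : Site d → Fin d → Matrix n n ℂ} (hψs : IsSkewDir ψ) (hψP' : IsPeriodicDir ψ ((N * L ^ (j + 2) : ℕ) : ℤ))
    (hex : ∀ (y : Site d) (κ : Fin d), pushDir L UB ψ ((L : ℤ) • y) κ = Y y κ)
    (hcurl : Real.sqrt (curlSq UB ψ (periodBox (N * L ^ (j + 2))))
        ≤ c₁ * Real.sqrt (curlSq (cavg L UB) Y (periodBox (N * L ^ (j + 1))))
          + c₂ * (b / ((L : ℝ) ^ (j + 2)) ^ 2) * Real.sqrt (dirSq Y (periodBox (N * L ^ (j + 1)))))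
    (hdirL1 : dirL1 ψ (periodBox (N * L ^ (j + 2))) ≤ c₃ * dirL1 Y (periodBox (N * L ^ (j + 1))))
    (hcurlL1 : curlL1 UB ψ (periodBox (N * L ^ (j + 2))) ≤ c₄ * dirL1 Y (periodBox (N * L ^ (j + 1)))) :
    |dAction (cavg L UB) Y (perWin d (N * L ^ (j + 1)))|
      ≤ (L : ℝ) ^ (4 - (d : ℤ)) * wallConst d L
          * (Real.sqrt (g * (N : ℝ) ^ d * ((L : ℝ) ^ (j + 2)) ^ d / ((L : ℝ) ^ (j + 2)) ^ 6)
              * (c₁ + c₂ * (b / ((L : ℝ) ^ (j + 2)) ^ 2) * (L : ℝ) ^ (j + 1))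
            + (b / ((L : ℝ) ^ (j + 2)) ^ 2) ^ 2 * (c₃ + c₄)
              * Real.sqrt (d * ((N * L ^ (j + 1) : ℕ) : ℝ) ^ d) * (L : ℝ) ^ (j + 1))
        * energyNormW L (j + 1) (cavg L UB) Y (periodBox (N * L ^ (j + 1))) := by
  -- arithmetic of the tower
  have hM : L * tower L N j = N * L ^ (j + 1) := by rw [tower_eq]; ring
  have hM2 : L * (L * tower L N j) = N * L ^ (j + 2) := by rw [hM]; ring
  have hL0 : (0 : ℝ) < L := by exact_mod_cast hL
  -- the data of (5a)
  have hV : IsUnitaryCfg UB := hreg.unitary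
  have hVP : IsPeriodicCfg UB ((L : ℤ) * (L * tower L N j : ℕ)) := by
    have h := hreg.periodic
    have hc : ((L : ℤ) * (L * tower L N j : ℕ)) = ((N * L ^ (j + 2) : ℕ) : ℤ) := by
      rw [← hM2]; push_cast; ring
    rw [hc]; exact h
  set a : ℝ := b / ((L : ℝ) ^ (j + 2)) ^ 2 with ha_def
  have ha : 0 ≤ a := div_nonneg hb (by positivity)
  have hab : a < ε / ((L : ℝ) ^ (j + 2)) ^ 2 := div_lt_div_of_pos_right hbε (by positivity)
  have hVa : SmallField UB a := hreg.small
  have hmin : ∀ U : Site d → Fin d → (Matrix n n ℂ)ˣ, IsUnitaryCfg U →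
      IsPeriodicCfg U ((L : ℤ) * (L * tower L N j : ℕ)) → SmallField U (ε / ((L : ℝ) ^ (j + 2)) ^ 2) →
        avgIter L U (j + 2) = avgIter L UB (j + 2) →
          fineAction UB (blockWindow L (periodBox (L * tower L N j))).2
            ≤ fineAction U (blockWindow L (periodBox (L * tower L N j))).2 := by
    intro U hU hUP hUb hUeq
    have hw : (blockWindow L (periodBox (d := d) (L * tower L N j))).2 = perWin d (N * L ^ (j + 2)) := by
      show blockSites L (periodBox (L * tower L N j)) ×ˢ Finset.univ = perWin d (N * L ^ (j + 2))
      rw [blockSites_periodBox L _ hL, hM2]; rfl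
    have hUP' : IsPeriodicCfg U ((N * L ^ (j + 2) : ℕ) : ℤ) := by
      have hc : ((L : ℤ) * (L * tower L N j : ℕ)) = ((N * L ^ (j + 2) : ℕ) : ℤ) := by
        rw [← hM2]; push_cast; ring
      rw [← hc]; exact hUP
    rw [hw]
    exact fineAction_le_of_isMinimiser hL hB U hU hUP' hUb hUeq
  -- the lift `ψ` of `Y`
  have hψP : IsPeriodicDir ψ ((L : ℤ) * (L * tower L N j : ℕ)) := by
    have hc : ((L : ℤ) * (L * tower L N j : ℕ)) = ((N * L ^ (j + 2) : ℕ) : ℤ) := by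
      rw [← hM2]; push_cast; ring
    rw [hc]; exact hψP'
  have hpush : cpush L UB ψ = Y := by
    funext y κ
    exact hex y κ
  have hψT : TangentIter L j (cavg L UB) (cpush L UB ψ) := by rw [hpush]; exact hYT
  -- the derivative: `D := dAction W Y (perWin)`, in coarse form along `pushDir L U_B ψ`
  set D : ℝ := dAction (cavg L UB) Y (perWin d (N * L ^ (j + 1))) with hD
  have hDfine : HasDerivAt (fun s : ℝ => fineAction (vary (cavg L UB) Y s) (perWin d (N * L ^ (j + 1)))) D 0 := by
    have h := hasDerivAt_fineAction_vary_at (cavg L UB) Y (perWin d (N * L ^ (j + 1))) 0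
    rwa [vary_zero] at h
  have hDc : HasDerivAt (fun s : ℝ => coarseActionOf L (vary (bavg L UB) (pushDir L UB ψ) s)
      (blockWindow L (periodBox (L * tower L N j))).1) D 0 := by
    have hw1 : (blockWindow L (periodBox (d := d) (L * tower L N j))).1 = perWin d (N * L ^ (j + 1)) := by
      show periodBox (L * tower L N j) ×ˢ Finset.univ = perWin d (N * L ^ (j + 1))
      rw [hM]; rfl
    rw [hw1]
    refine hDfine.congr_of_eventuallyEq (Filter.Eventually.of_forall fun s => ?_)
    show coarseActionOf L (vary (bavg L UB) (pushDir L UB ψ) s) (perWin d (N * L ^ (j + 1)))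
      = fineAction (vary (cavg L UB) Y s) (perWin d (N * L ^ (j + 1)))
    rw [fineAction_vary_cavg hL UB Y s]
    refine coarseActionOf_vary_congr L (bavg L UB) (fun y κ => ?_) s _
    rw [liftDir_smul hL]
    exact hex y κ
  -- (5a)
  have key := residualPairing_avgIter j hV hVP ha hab hsmall hVa hmin hψs hψP hψT hDc
  rw [hM] at key
  -- the blocks of run A's period are run B's period
  have hbl : blockSites L (periodBox (d := d) (N * L ^ (j + 1))) = periodBox (N * L ^ (j + 2)) := by
    rw [blockSites_periodBox L _ hL, show L * (N * L ^ (j + 1)) = N * L ^ (j + 2) by ring]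
  rw [hbl] at key
  -- the norms of the lift against the weighted energy norm of `Y`
  set F : Finset (Site d) := periodBox (N * L ^ (j + 1)) with hF
  set E : ℝ := energyNormW L (j + 1) (cavg L UB) Y F with hE
  have hE0 : 0 ≤ E := energyNormW_nonneg _ _ _ _ _
  have hLk : (0 : ℝ) ≤ (L : ℝ) ^ (j + 1) := by positivity
  have hcurlY : Real.sqrt (curlSq (cavg L UB) Y F) ≤ E := sqrt_curlSq_le_energyNormW L (j + 1) _ Y F
  have hdirY : Real.sqrt (dirSq Y F) ≤ (L : ℝ) ^ (j + 1) * E := sqrt_dirSq_le_pow_mul_energyNormW hL (j + 1) _ Y F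
  have hdirL1Y : dirL1 Y F ≤ Real.sqrt (d * ((N * L ^ (j + 1) : ℕ) : ℝ) ^ d) * ((L : ℝ) ^ (j + 1) * E) := by
    have h := dirL1_le_sqrt_mul_sqrt_dirSq (N * L ^ (j + 1)) Y
    push_cast at h ⊢
    exact h.trans (mul_le_mul_of_nonneg_left hdirY (Real.sqrt_nonneg _))
  have h1 : Real.sqrt (curlSq UB ψ (periodBox (N * L ^ (j + 2)))) ≤ (c₁ + c₂ * a * (L : ℝ) ^ (j + 1)) * E := by
    calc Real.sqrt (curlSq UB ψ (periodBox (N * L ^ (j + 2))))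
        ≤ c₁ * Real.sqrt (curlSq (cavg L UB) Y F) + c₂ * a * Real.sqrt (dirSq Y F) := hcurl
      _ ≤ c₁ * E + c₂ * a * ((L : ℝ) ^ (j + 1) * E) :=
          add_le_add (mul_le_mul_of_nonneg_left hcurlY hc₁) (mul_le_mul_of_nonneg_left hdirY (mul_nonneg hc₂ ha))
      _ = (c₁ + c₂ * a * (L : ℝ) ^ (j + 1)) * E := by ring
  have h2 : dirL1 ψ (periodBox (N * L ^ (j + 2))) + curlL1 UB ψ (periodBox (N * L ^ (j + 2)))
      ≤ (c₃ + c₄) * Real.sqrt (d * ((N * L ^ (j + 1) : ℕ) : ℝ) ^ d) * (L : ℝ) ^ (j + 1) * E := by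
    have h34 : dirL1 ψ (periodBox (N * L ^ (j + 2))) + curlL1 UB ψ (periodBox (N * L ^ (j + 2))) ≤ (c₃ + c₄) * dirL1 Y F := by
      rw [add_mul]; exact add_le_add hdirL1 hcurlL1
    refine h34.trans ?_
    have := mul_le_mul_of_nonneg_left hdirL1Y (add_nonneg hc₃ hc₄)
    refine this.trans (le_of_eq ?_)
    ring
  -- assemble the bracket
  have hW0 := wallConst_nonneg d L
  have hg0 : 0 ≤ Real.sqrt (gradFluxSq UB (periodBox (N * L ^ (j + 2)))) := Real.sqrt_nonneg _
  have hgrad : Real.sqrt (gradFluxSq UB (periodBox (N * L ^ (j + 2))))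
      ≤ Real.sqrt (g * (N : ℝ) ^ d * ((L : ℝ) ^ (j + 2)) ^ d / ((L : ℝ) ^ (j + 2)) ^ 6) :=
    Real.sqrt_le_sqrt hreg.grad
  set R : ℝ := Real.sqrt (g * (N : ℝ) ^ d * ((L : ℝ) ^ (j + 2)) ^ d / ((L : ℝ) ^ (j + 2)) ^ 6)
      * (c₁ + c₂ * a * (L : ℝ) ^ (j + 1))
    + a ^ 2 * (c₃ + c₄) * Real.sqrt (d * ((N * L ^ (j + 1) : ℕ) : ℝ) ^ d) * (L : ℝ) ^ (j + 1) with hR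
  have hbr : wallConst d L * (Real.sqrt (gradFluxSq UB (periodBox (N * L ^ (j + 2))))
        * Real.sqrt (curlSq UB ψ (periodBox (N * L ^ (j + 2))))
        + a ^ 2 * (dirL1 ψ (periodBox (N * L ^ (j + 2))) + curlL1 UB ψ (periodBox (N * L ^ (j + 2)))))
      ≤ wallConst d L * (R * E) := by
    refine mul_le_mul_of_nonneg_left ?_ hW0
    have hc12 : 0 ≤ c₁ + c₂ * a * (L : ℝ) ^ (j + 1) := by positivity
    have t1 : Real.sqrt (gradFluxSq UB (periodBox (N * L ^ (j + 2)))) * Real.sqrt (curlSq UB ψ (periodBox (N * L ^ (j + 2))))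
        ≤ Real.sqrt (g * (N : ℝ) ^ d * ((L : ℝ) ^ (j + 2)) ^ d / ((L : ℝ) ^ (j + 2)) ^ 6)
          * ((c₁ + c₂ * a * (L : ℝ) ^ (j + 1)) * E) :=
      mul_le_mul hgrad h1 (Real.sqrt_nonneg _) ((Real.sqrt_nonneg _).trans hgrad)
    have t2 : a ^ 2 * (dirL1 ψ (periodBox (N * L ^ (j + 2))) + curlL1 UB ψ (periodBox (N * L ^ (j + 2))))
        ≤ a ^ 2 * ((c₃ + c₄) * Real.sqrt (d * ((N * L ^ (j + 1) : ℕ) : ℝ) ^ d) * (L : ℝ) ^ (j + 1) * E) :=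
      mul_le_mul_of_nonneg_left h2 (sq_nonneg a)
    rw [hR]
    nlinarith
  have key' := key.trans hbr
  -- divide by `L^{d−4}`
  have hzp : (0 : ℝ) < (L : ℝ) ^ ((d : ℤ) - 4) := zpow_pos hL0 _
  have hinv : ((L : ℝ) ^ ((d : ℤ) - 4))⁻¹ = (L : ℝ) ^ (4 - (d : ℤ)) := by
    rw [← zpow_neg]; congr 1; ring
  have hfin : |D| ≤ (L : ℝ) ^ (4 - (d : ℤ)) * (wallConst d L * (R * E)) := by
    rw [← hinv, ← div_eq_inv_mul, le_div_iff₀ hzp, mul_comm]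
    exact key'
  refine hfin.trans (le_of_eq ?_)
  rw [hR, ha_def]
  ring

/-! ## §3 The socket (RES♯) by name -/

/-- **(RES♯) `CurlPairedResidual` BY NAME, MODULO THE EXISTENCE OF EXACT CURL-CONTROLLED LIFTS (R♯3b∕R♯4).**  Under the setting of
`abs_dAction_le_of_exact_lift`: if every skew `(N·L^{j+1})`-periodic `Y` tangent to run A's fibre at `W = cavg L U_B` admits SOME
skew `(N·L^{j+2})`-periodic push-exact lift `ψ` with the three norm bounds (constants `c₁, …, c₄ ≥ 0`), then for every direction
set `T` of skew, `(N·L^{j+1})`-periodic, tangent directions: `CurlPairedResidual L (j+1) W T r (periodBox (N·L^{j+1}))` with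
`r = L^{4−d}·wallConst·[√(g·N^d·(L^{j+2})^d∕(L^{j+2})^6)·(c₁ + c₂·a·L^{j+1}) + a²·(c₃ + c₄)·√(d·(N·L^{j+1})^d)·L^{j+1}]`,
`a = b∕(L^{j+2})²`. [folklore] -/
theorem curlPairedResidual_of_exists_lift [Nonempty n] {L N : ℕ} [NeZero L] [NeZero N] (hL : 1 ≤ L) (j : ℕ) {ε b g : ℝ}
    (hb : 0 ≤ b) (hbε : b < ε) (hsmall : LevelSmall d L (j + 1) (ε / ((L : ℝ) ^ (j + 2)) ^ 2))
    {V UB : Site d → Fin d → (Matrix n n ℂ)ˣ} (hB : IsMinimiser d (sfClass d L N ε) L N (j + 2) V UB)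
    (hreg : Regular d L N b g (j + 2) UB) {c₁ c₂ c₃ c₄ : ℝ} (hc₁ : 0 ≤ c₁) (hc₂ : 0 ≤ c₂) (hc₃ : 0 ≤ c₃) (hc₄ : 0 ≤ c₄)
    (hlift : ∀ Y : Site d → Fin d → Matrix n n ℂ, IsSkewDir Y → IsPeriodicDir Y ((N * L ^ (j + 1) : ℕ) : ℤ) →
      TangentIter L j (cavg L UB) Y → ∃ ψ : Site d → Fin d → Matrix n n ℂ,
        IsSkewDir ψ ∧ IsPeriodicDir ψ ((N * L ^ (j + 2) : ℕ) : ℤ)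
        ∧ (∀ (y : Site d) (κ : Fin d), pushDir L UB ψ ((L : ℤ) • y) κ = Y y κ)
        ∧ Real.sqrt (curlSq UB ψ (periodBox (N * L ^ (j + 2))))
            ≤ c₁ * Real.sqrt (curlSq (cavg L UB) Y (periodBox (N * L ^ (j + 1))))
              + c₂ * (b / ((L : ℝ) ^ (j + 2)) ^ 2) * Real.sqrt (dirSq Y (periodBox (N * L ^ (j + 1))))
        ∧ dirL1 ψ (periodBox (N * L ^ (j + 2))) ≤ c₃ * dirL1 Y (periodBox (N * L ^ (j + 1)))
        ∧ curlL1 UB ψ (periodBox (N * L ^ (j + 2))) ≤ c₄ * dirL1 Y (periodBox (N * L ^ (j + 1))))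
    {T : Set (Site d → Fin d → Matrix n n ℂ)}
    (hT : ∀ Y ∈ T, IsSkewDir Y ∧ IsPeriodicDir Y ((N * L ^ (j + 1) : ℕ) : ℤ) ∧ TangentIter L j (cavg L UB) Y) :
    CurlPairedResidual L (j + 1) (cavg L UB) T
      ((L : ℝ) ^ (4 - (d : ℤ)) * wallConst d L
          * (Real.sqrt (g * (N : ℝ) ^ d * ((L : ℝ) ^ (j + 2)) ^ d / ((L : ℝ) ^ (j + 2)) ^ 6)
              * (c₁ + c₂ * (b / ((L : ℝ) ^ (j + 2)) ^ 2) * (L : ℝ) ^ (j + 1))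
            + (b / ((L : ℝ) ^ (j + 2)) ^ 2) ^ 2 * (c₃ + c₄)
              * Real.sqrt (d * ((N * L ^ (j + 1) : ℕ) : ℝ) ^ d) * (L : ℝ) ^ (j + 1)))
      (periodBox (N * L ^ (j + 1))) := by
  intro Y hY
  obtain ⟨hYs, hYP, hYT⟩ := hT Y hY
  obtain ⟨ψ, hψs, hψP, hex, hcurl, hdirL1, hcurlL1⟩ := hlift Y hYs hYP hYT
  exact abs_dAction_le_of_exact_lift hL j hb hbε hsmall hB hreg hc₁ hc₂ hc₃ hc₄ Y hYT hψs hψP hex hcurl hdirL1 hcurlL1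

/-- **(RES♯) `CurlPairedResidual` BY NAME, for a lift OPERATOR.**  The special case of `curlPairedResidual_of_exists_lift` in which
the lifts are the values of one map `lift` (e.g. an exact dressed replication map) satisfying the six properties on all skew
`(N·L^{j+1})`-periodic directions. [folklore] -/
theorem curlPairedResidual_of_lift [Nonempty n] {L N : ℕ} [NeZero L] [NeZero N] (hL : 1 ≤ L) (j : ℕ) {ε b g : ℝ}
    (hb : 0 ≤ b) (hbε : b < ε) (hsmall : LevelSmall d L (j + 1) (ε / ((L : ℝ) ^ (j + 2)) ^ 2))
    {V UB : Site d → Fin d → (Matrix n n ℂ)ˣ} (hB : IsMinimiser d (sfClass d L N ε) L N (j + 2) V UB)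
    (hreg : Regular d L N b g (j + 2) UB)
    (lift : (Site d → Fin d → Matrix n n ℂ) → Site d → Fin d → Matrix n n ℂ) {c₁ c₂ c₃ c₄ : ℝ}
    (hc₁ : 0 ≤ c₁) (hc₂ : 0 ≤ c₂) (hc₃ : 0 ≤ c₃) (hc₄ : 0 ≤ c₄)
    (hLskew : ∀ Y, IsSkewDir Y → IsPeriodicDir Y ((N * L ^ (j + 1) : ℕ) : ℤ) → IsSkewDir (lift Y))
    (hLper : ∀ Y, IsSkewDir Y → IsPeriodicDir Y ((N * L ^ (j + 1) : ℕ) : ℤ) → IsPeriodicDir (lift Y) ((N * L ^ (j + 2) : ℕ) : ℤ))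
    (hLex : ∀ Y, IsSkewDir Y → IsPeriodicDir Y ((N * L ^ (j + 1) : ℕ) : ℤ) →
      ∀ (y : Site d) (κ : Fin d), pushDir L UB (lift Y) ((L : ℤ) • y) κ = Y y κ)
    (hLcurl : ∀ Y, IsSkewDir Y → IsPeriodicDir Y ((N * L ^ (j + 1) : ℕ) : ℤ) →
      Real.sqrt (curlSq UB (lift Y) (periodBox (N * L ^ (j + 2))))
        ≤ c₁ * Real.sqrt (curlSq (cavg L UB) Y (periodBox (N * L ^ (j + 1))))
          + c₂ * (b / ((L : ℝ) ^ (j + 2)) ^ 2) * Real.sqrt (dirSq Y (periodBox (N * L ^ (j + 1)))))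
    (hLdirL1 : ∀ Y, IsSkewDir Y → IsPeriodicDir Y ((N * L ^ (j + 1) : ℕ) : ℤ) →
      dirL1 (lift Y) (periodBox (N * L ^ (j + 2))) ≤ c₃ * dirL1 Y (periodBox (N * L ^ (j + 1))))
    (hLcurlL1 : ∀ Y, IsSkewDir Y → IsPeriodicDir Y ((N * L ^ (j + 1) : ℕ) : ℤ) →
      curlL1 UB (lift Y) (periodBox (N * L ^ (j + 2))) ≤ c₄ * dirL1 Y (periodBox (N * L ^ (j + 1))))
    {T : Set (Site d → Fin d → Matrix n n ℂ)}
    (hT : ∀ Y ∈ T, IsSkewDir Y ∧ IsPeriodicDir Y ((N * L ^ (j + 1) : ℕ) : ℤ) ∧ TangentIter L j (cavg L UB) Y) :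
    CurlPairedResidual L (j + 1) (cavg L UB) T
      ((L : ℝ) ^ (4 - (d : ℤ)) * wallConst d L
          * (Real.sqrt (g * (N : ℝ) ^ d * ((L : ℝ) ^ (j + 2)) ^ d / ((L : ℝ) ^ (j + 2)) ^ 6)
              * (c₁ + c₂ * (b / ((L : ℝ) ^ (j + 2)) ^ 2) * (L : ℝ) ^ (j + 1))
            + (b / ((L : ℝ) ^ (j + 2)) ^ 2) ^ 2 * (c₃ + c₄)
              * Real.sqrt (d * ((N * L ^ (j + 1) : ℕ) : ℝ) ^ d) * (L : ℝ) ^ (j + 1)))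
      (periodBox (N * L ^ (j + 1))) :=
  curlPairedResidual_of_exists_lift hL j hb hbε hsmall hB hreg hc₁ hc₂ hc₃ hc₄
    (fun Y hYs hYP _ => ⟨lift Y, hLskew Y hYs hYP, hLper Y hYs hYP, hLex Y hYs hYP, hLcurl Y hYs hYP, hLdirL1 Y hYs hYP,
      hLcurlL1 Y hYs hYP⟩) hT

end

end Summit.QuantumFields.BalabanUV.T4Continuum.NE3CurlPairedResidualEnd
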